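import Summits.CriticalPhenomena.SAWScalingLimit.Theorems.ShellCrossingBound.Negative.Forcing3Component

/-!
# `ShellCrossingBound` — negative knowledge: forcing corridors (the uniform-threshold Aizenman–Burchard hypothesis is false for the critical SAW)

Part 4: resolution thresholds exist (`exists_good`, uniform continuity), the resolution scale `xres δ → 0`, ranges and endpoints of polylines of walks, and the SAW law is a probability measure once the endpoints are joined (`isProbabilityMeasure_law`).

Support file for crux `stmt-CriticalPhenomena-4728` (refuter `cdisprove`; work file
`Summits/CriticalPhenomena/SAWScalingLimit/Cruxes/ShellCrossingBound/Disproof.lean`; conclusion in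
`Negative/UniformThresholdFalse.lean`). Everything proved. [folklore]
-/

noncomputable section

open Set Filter Topology Metric MeasureTheory Complex
open scoped ENNReal Real
open Literature.Probability.RandomPlanarGeometry Literature.Probability.LatticeModels

namespace Summit.CriticalPhenomena.SAWScalingLimit.Theorems.ShellCrossingBound.Negative.Forcing

/-! ## E.1 Resolution thresholds exist; the resolution scale `xres δ → 0` -/

/-- For every `x₀ ∈ (0, 1/4]` all small meshes resolve the domain to the right of `x₀`
(uniform continuity of the centre line on `[x₀, 1]`). [folklore] -/
theorem exists_good {x₀ : ℝ} (hx₀ : 0 < x₀) (hx₁ : x₀ ≤ 1 / 4) :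
    ∃ d : ℝ, 0 < d ∧ ∀ δ : ℝ, 0 < δ → δ ≤ d → Good δ x₀ := by
  have hK : IsCompact (Icc x₀ 1) := isCompact_Icc
  have hu := hK.uniformContinuousOn_of_continuous continuous_ctr.continuousOn
  have hε : 0 < sl * x₀ / 4 := by have := sl_pos; positivity
  obtain ⟨η, hη, hcont⟩ := Metric.uniformContinuousOn_iff.1 hu (sl * x₀ / 4) hε
  refine ⟨min (η / 2) (sl * x₀ / 8), lt_min (by linarith) (by linarith), fun δ hδ hδd => ?_⟩
  have hδη : δ ≤ η / 2 := hδd.trans (min_le_left _ _)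
  have hδs : δ ≤ sl * x₀ / 8 := hδd.trans (min_le_right _ _)
  refine ⟨hδ, hx₀, hx₁, by linarith, fun x x' h1 h2 h3 h4 => ?_⟩
  have hx : x ∈ Icc x₀ 1 := ⟨h1, h2.trans h4⟩
  have hx' : x' ∈ Icc x₀ 1 := ⟨h1.trans h2, h4⟩
  have hd : dist x' x < η := by
    rw [Real.dist_eq, abs_of_nonneg (by linarith)]; linarith
  have := hcont x' hx' x hx hd
  rw [Real.dist_eq] at this
  exact this.le

/-- Dyadic levels `x_n = 2^{-n}/4`. [folklore] -/
def xlev (n : ℕ) : ℝ := 1 / 4 * (1 / 2) ^ n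

/-- Dyadic levels are positive. [folklore] -/
theorem xlev_pos (n : ℕ) : 0 < xlev n := by unfold xlev; positivity

/-- Dyadic levels are at most `1/4`. [folklore] -/
theorem xlev_le (n : ℕ) : xlev n ≤ 1 / 4 := by
  unfold xlev
  have : (1 / 2 : ℝ) ^ n ≤ 1 := pow_le_one₀ (by norm_num) (by norm_num)
  linarith

/-- Dyadic levels decrease. [folklore] -/
theorem xlev_antitone : Antitone xlev := by
  intro m n hmn
  unfold xlev
  have : (1 / 2 : ℝ) ^ n ≤ (1 / 2) ^ m := pow_le_pow_of_le_one (by norm_num) (by norm_num) hmn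
  linarith

/-- Resolution threshold of level `n` (from `exists_good`). [folklore] -/
def dgood (n : ℕ) : ℝ := (exists_good (xlev_pos n) (xlev_le n)).choose

/-- Specification of the resolution threshold of a level. [folklore] -/
theorem dgood_spec (n : ℕ) : 0 < dgood n ∧ ∀ δ : ℝ, 0 < δ → δ ≤ dgood n → Good δ (xlev n) :=
  (exists_good (xlev_pos n) (xlev_le n)).choose_spec

/-- Monotone thresholds: `dmin n ≤ dgood n`, `dmin n ≤ xlev n`, `dmin n ≤ 1/(n+1)`, antitone. [folklore] -/
def dmin : ℕ → ℝ
  | 0 => min (dgood 0) (min (xlev 0) 1)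
  | n + 1 => min (dmin n) (min (dgood (n + 1)) (min (xlev (n + 1)) (1 / (n + 2))))

/-- The monotone thresholds are positive. [folklore] -/
theorem dmin_pos : ∀ n, 0 < dmin n
  | 0 => by
    unfold dmin
    exact lt_min (dgood_spec 0).1 (lt_min (xlev_pos 0) one_pos)
  | n + 1 => by
    rw [dmin]
    refine lt_min (dmin_pos n) (lt_min (dgood_spec _).1 (lt_min (xlev_pos _) (by positivity)))

/-- The monotone threshold is below the level threshold. [folklore] -/
theorem dmin_le_dgood : ∀ n, dmin n ≤ dgood n
  | 0 => by unfold dmin; exact min_le_left _ _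
  | n + 1 => by rw [dmin]; exact (min_le_right _ _).trans (min_le_left _ _)

/-- The monotone threshold is below the level. [folklore] -/
theorem dmin_le_xlev : ∀ n, dmin n ≤ xlev n
  | 0 => by unfold dmin; exact (min_le_right _ _).trans (min_le_left _ _)
  | n + 1 => by
    rw [dmin]; exact (min_le_right _ _).trans ((min_le_right _ _).trans (min_le_left _ _))

/-- The monotone threshold is below `1/(n+1)`. [folklore] -/
theorem dmin_le_inv : ∀ n : ℕ, dmin n ≤ 1 / (n + 1)
  | 0 => by unfold dmin; norm_num
  | n + 1 => by
    rw [dmin]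
    refine (min_le_right _ _).trans ((min_le_right _ _).trans ((min_le_right _ _).trans ?_))
    push_cast
    ring_nf
    rfl

/-- The monotone thresholds decrease (one step). [folklore] -/
theorem dmin_succ_le (n : ℕ) : dmin (n + 1) ≤ dmin n := by rw [dmin]; exact min_le_left _ _

/-- The monotone thresholds decrease. [folklore] -/
theorem dmin_antitone : Antitone dmin := antitone_nat_of_succ_le dmin_succ_le

open Classical in
/-- The resolution level of mesh `δ`: the largest `n ≤ ⌈1/δ⌉₊` with `δ ≤ dmin n`. [folklore] -/
def nlev (δ : ℝ) : ℕ := Nat.findGreatest (fun n => δ ≤ dmin n) ⌈1 / δ⌉₊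

/-- The resolution abscissa of mesh `δ`. [folklore] -/
def xres (δ : ℝ) : ℝ := xlev (nlev δ)

/-- The resolution abscissa is positive. [folklore] -/
theorem xres_pos (δ : ℝ) : 0 < xres δ := xlev_pos _

/-- The resolution abscissa is at most `1/4`. [folklore] -/
theorem xres_le_quarter (δ : ℝ) : xres δ ≤ 1 / 4 := xlev_le _

/-- If `δ ≤ dmin n₀` then the resolution level is at least `n₀`. [folklore] -/
theorem le_nlev {δ : ℝ} (hδ : 0 < δ) {n₀ : ℕ} (h : δ ≤ dmin n₀) : n₀ ≤ nlev δ := by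
  classical
  unfold nlev
  refine Nat.le_findGreatest ?_ h
  -- `δ ≤ dmin n₀ ≤ 1/(n₀+1)` forces `n₀ ≤ ⌈1/δ⌉₊`
  have h1 : δ ≤ 1 / (n₀ + 1) := h.trans (dmin_le_inv n₀)
  have h2 : (n₀ : ℝ) + 1 ≤ 1 / δ := by
    rw [le_div_iff₀ hδ]
    rw [le_div_iff₀ (by positivity)] at h1
    linarith
  have h3 : (n₀ : ℝ) ≤ ⌈1 / δ⌉₊ := by
    have := Nat.le_ceil (1 / δ)
    linarith
  exact_mod_cast h3

/-- Below `dmin 0` the resolution level satisfies its defining predicate. [folklore] -/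
theorem nlev_spec {δ : ℝ} (h : δ ≤ dmin 0) : δ ≤ dmin (nlev δ) := by
  classical
  unfold nlev
  exact Nat.findGreatest_spec (P := fun n => δ ≤ dmin n) (Nat.zero_le _) h

/-- **Small meshes resolve the domain to the right of `xres δ`.** [folklore] -/
theorem good_xres {δ : ℝ} (hδ : 0 < δ) (h : δ ≤ dmin 0) : Good δ (xres δ) :=
  (dgood_spec (nlev δ)).2 δ hδ ((nlev_spec h).trans (dmin_le_dgood _))

/-- **`xres δ → 0`**: below `dmin n₀` the resolution abscissa is at most `xlev n₀`. [folklore] -/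
theorem xres_le {δ : ℝ} (hδ : 0 < δ) {n₀ : ℕ} (h : δ ≤ dmin n₀) : xres δ ≤ xlev n₀ :=
  xlev_antitone (le_nlev hδ h)

/-- Dyadic levels become arbitrarily small. [folklore] -/
theorem exists_xlev_lt {ε : ℝ} (hε : 0 < ε) : ∃ n, xlev n < ε := by
  obtain ⟨n, hn⟩ := exists_pow_lt_of_lt_one (show 0 < 4 * ε by positivity) (show (1 / 2 : ℝ) < 1 by norm_num)
  exact ⟨n, by unfold xlev; linarith⟩


/-! ## E.2 Polylines of walks: range and endpoint; the SAW law is a probability measure -/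

section Polyline

variable {E : Type*} [AddCommGroup E] [Module ℝ E] [TopologicalSpace E] [ContinuousAdd E]
  [ContinuousSMul ℝ E]

/-- A polyline whose consecutive segments lie in `S` has range in `S`. [folklore] -/
theorem range_polylineFrom_subset {S : Set E} :
    ∀ (l : List E) (a : E), a ∈ S → List.IsChain (fun x y => segment ℝ x y ⊆ S) (a :: l) →
      Set.range (polylineFrom a l).2 ⊆ S
  | [], a, ha, _ => by
    rintro _ ⟨t, rfl⟩
    have h : ((polylineFrom a []).2 : unitInterval → E) t = a := rfl
    rw [h]
    exact ha
  | b :: l, a, _, hc => by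
    rw [List.isChain_cons_cons] at hc
    obtain ⟨hab, hc⟩ := hc
    have hb : b ∈ S := hab (right_mem_segment ℝ a b)
    rw [polylineFrom_cons, Path.trans_range, Path.range_segment]
    exact union_subset hab (range_polylineFrom_subset l b hb hc)

end Polyline

/-- The polyline of a walk whose edges are segments in `S` (and start in `S`) stays in `S`. [folklore] -/
theorem range_toCurve_subset {V : Type*} {G : SimpleGraph V} (emb : V → ℂ) {S : Set ℂ}
    (hS : ∀ x y, G.Adj x y → segment ℝ (emb x) (emb y) ⊆ S) {u v : V} (w : G.Walk u v)
    (hu : emb u ∈ S) : Set.range (w.toCurve emb) ⊆ S := by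
  have hchain : List.IsChain (fun x y => segment ℝ x y ⊆ S) (w.support.map emb) :=
    List.isChain_map_of_isChain emb (fun a b h => hS a b h) w.isChain_adj_support
  have hsupp : w.support.map emb = emb u :: (w.support.tail.map emb) := by
    conv_lhs => rw [← w.cons_tail_support]
    rfl
  unfold SimpleGraph.Walk.toCurve
  rw [hsupp] at hchain ⊢
  exact range_polylineFrom_subset _ _ hu hchain

/-- The polyline of a walk ends at the (embedded) final vertex. [folklore] -/
theorem toCurve_apply_one {V : Type*} {G : SimpleGraph V} (emb : V → ℂ) {u v : V} (w : G.Walk u v) :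
    w.toCurve emb 1 = emb v := by
  have hsupp : w.support.map emb = emb u :: (w.support.tail.map emb) := by
    conv_lhs => rw [← w.cons_tail_support]
    rfl
  have key : ∀ (L : List ℂ) (hL : L ≠ []), L = w.support.map emb → L.getLast hL = emb v := by
    rintro L hL rfl
    rw [List.getLast_map, SimpleGraph.Walk.getLast_support]
  unfold SimpleGraph.Walk.toCurve
  rw [hsupp, polyline_apply_one]
  exact key _ _ hsupp.symm

/-- For a bounded domain, a positive mesh and joined endpoints, the critical SAW law is a
probability measure (finitely many SAWs, positive finite total weight). Extracted from the route
file's deciding theorem. [folklore] -/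
theorem isProbabilityMeasure_law {Ω : Set ℂ} (hΩ : Bornology.IsBounded Ω) {δ : ℝ} (hδ : 0 < δ)
    {a b : Site 2} (hreach : (discreteDomainGraph Ω δ).Reachable a b) :
    IsProbabilityMeasure (SAW.law Ω δ a b) := by
  classical
  have hxc : 0 < SAW.criticalFugacity := by
    have h := SAW.Zd.connectiveConstant_pos 2
    rw [SAW.Zd.connectiveConstant_two] at h
    unfold SAW.criticalFugacity
    exact inv_pos.2 h
  have hfin : (meshDomain Ω δ).Finite := meshDomain_finite hΩ hδ
  haveI hLF : (discreteDomainGraph Ω δ).LocallyFinite :=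
    fun v => (hfin.subset fun w hw =>
      (discreteDomainGraph_adj_iff.1 ((SimpleGraph.mem_neighborSet _ _ _).1 hw)).2.2).fintype
  have hsupp : ∀ {u v : Site 2} (p : (discreteDomainGraph Ω δ).Walk u v),
      ∀ w ∈ p.support.tail, w ∈ meshDomain Ω δ := by
    intro u v p
    induction p with
    | nil => intro w hw; simp at hw
    | cons h q ih =>
      intro w hw
      rw [SimpleGraph.Walk.support_cons, List.tail_cons, SimpleGraph.Walk.mem_support_iff] at hw
      rcases hw with rfl | hw
      · exact (discreteDomainGraph_adj_iff.1 h).2.2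
      · exact ih w hw
  have hlen : ∀ {u v : Site 2} (p : (discreteDomainGraph Ω δ).Walk u v),
      p.IsPath → p.length < hfin.toFinset.card + 1 := by
    intro u v p hp
    have hnd : p.support.tail.Nodup := List.Nodup.sublist (List.tail_sublist _) hp.support_nodup
    have h1 : p.support.tail.length = p.length := by
      rw [List.length_tail, SimpleGraph.Walk.length_support]
      rfl
    have h2 : p.support.tail.toFinset ⊆ hfin.toFinset := by
      intro w hw
      rw [Set.Finite.mem_toFinset]
      exact hsupp p w (List.mem_toFinset.1 hw)
    have h3 := Finset.card_le_card h2
    rw [List.toFinset_card_of_nodup hnd, h1] at h3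
    omega
  haveI hfinite : Finite (SAW.DomainSAW Ω δ a b) := by
    refine Finite.of_injective
      (β := {p : (discreteDomainGraph Ω δ).Walk a b // p.IsPath ∧ p.length < hfin.toFinset.card + 1})
      (fun γ => ⟨γ.walk, γ.isPath, hlen γ.walk γ.isPath⟩) ?_
    rintro ⟨p, hp⟩ ⟨q, hq⟩ h
    have hpq : p = q := congrArg Subtype.val h
    cases hpq
    rfl
  haveI := Fintype.ofFinite (SAW.DomainSAW Ω δ a b)
  have huniv : SAW.weight Ω δ a b Set.univ =
      ∑' γ : SAW.DomainSAW Ω δ a b, ENNReal.ofReal (SAW.criticalFugacity ^ γ.length) := by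
    rw [SAW.weight, MeasureTheory.Measure.sum_apply _ MeasurableSet.univ]
    simp
  have htop : SAW.weight Ω δ a b Set.univ ≠ ⊤ := by
    rw [huniv, tsum_fintype]
    exact ENNReal.sum_ne_top.2 fun _ _ => ENNReal.ofReal_ne_top
  have h0 : SAW.weight Ω δ a b Set.univ ≠ 0 := by
    obtain ⟨p⟩ := hreach
    let γ₀ : SAW.DomainSAW Ω δ a b := ⟨p.bypass, p.bypass_isPath⟩
    have h1 : SAW.weight Ω δ a b {γ₀} ≤ SAW.weight Ω δ a b Set.univ := measure_mono (Set.subset_univ _)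
    rw [SAW.weight_singleton] at h1
    have h2 : 0 < ENNReal.ofReal (SAW.criticalFugacity ^ γ₀.length) :=
      ENNReal.ofReal_pos.2 (pow_pos hxc _)
    exact (h2.trans_le h1).ne'
  constructor
  rw [SAW.law, Measure.smul_apply, smul_eq_mul, ENNReal.inv_mul_cancel h0 htop]

end Summit.CriticalPhenomena.SAWScalingLimit.Theorems.ShellCrossingBound.Negative.Forcing
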